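import Summits.ValiantsHypothesis.ValiantsHypothesis.Theorems.EquivariantDialLayersApolarPairing
import HarnessLib

/-!
# The depth window of `R_d`: only types `λ ⊠ μ` with `λ₁, μ₁ ≥ m - d` occur in degree `d`

Support for the census cell W36 (leaf `R^lay = IdealWidthSuperpoly biPermSubst`) only; `IdealWidthSuperpoly`,
`EqHardLayered biPermSubst` (`A^lay`), `EqHardBiPerm` (cell A), stmt-ValiantsHypothesis-23702 and `VP ≠ VNP` are untouched
and proved by nothing here; mechanism KNOWN (coefficient/apolarity pairing = transpose of a monomial substitution; isotypic
projectors, Serre §2.6 Thm 8; Pieri–Young depth window); inside the catalogued equivariance barrier (Landsberg–Ressayre 2017,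
Dawar–Wilsenach 2020); `d = 2` is `EquivariantDialLayersQuadricTypes.sum_boxProd_smul_rename_eq_zero` — this file is the
parameter generalisation `2 ↦ d` of that move (a variant of an own move, graded as such). Lane `--supports`: nothing here
closes a route item. File R4a of the «block-witness apolar bound» programme (`EquivariantDialLayers`).
A monomial `x^β` of degree `d ≤ m` involves at most `d` row letters and at most `d` column letters, so it is fixed by
`K × K'`, `K, K' ≅ 𝔖_{m-d}` pointwise stabilisers of `d` letters; by Pieri (`…ApolarKill.le_getD_add_of_sum_ne_zero`)
`∑_K χ^λ ≠ 0` forces `λ₁ ≥ m - d`; and an isotypic component without `K × K'`-fixed vectors kills a fixed vector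
(`…QuadricTypes.isotypicProj_eq_zero_of_sum_eq_zero`), on the cyclic module of `x^β`
(`…ApolarPairing.exists_representation_of_stable`, the only representation construction of the series).
* §1 a splitting `[a] ⊔ [m-a] ≃ [m]` whose `𝔖_{m-a}` fixes a given set of `≤ a` letters; monomials whose letters are
  fixed are fixed; a degree-`d` exponent has `≤ d` rows and `≤ d` columns.
* §2 ★ `sum_boxProd_smul_rename_monomial_eq_zero`: for `λ₁ < m - d` or `μ₁ < m - d` the `χ^λ ⊠ χ^μ`-weighted
  symmetriser kills every monomial of degree `d`; ★★ DEPTH WINDOW `…_of_isHomogeneous`: it kills every form of degree `d`.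
References: [cite: SerreLinearRepresentations1977, §2.6 Thm. 8]; [cite: BurgisserEtAl2011, Prop. 4.5.4];
[cite: JamesLiebeck2001, 29.13 (Young's rule)].
-/

set_option linter.dupNamespace false

namespace Summit.ValiantsHypothesis.ValiantsHypothesis.Theorems.EquivariantDialLayersDepthWindow

open MvPolynomial
open Equiv (Perm)
open Literature.RepresentationTheory.FiniteGroups
open Literature.NumberTheory.DiophantineGeometry (spechtCharacter)
open Summit.ValiantsHypothesis.ValiantsHypothesis.Theorems.EquivariantDialLayersQuadricTypes
open Summit.ValiantsHypothesis.ValiantsHypothesis.Theorems.EquivariantDialLayersApolarKill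
open Summit.ValiantsHypothesis.ValiantsHypothesis.Theorems.EquivariantDialLayersApolarPairing

variable {m : ℕ}

/-! ## §1 Splittings fixing a set of letters; fixed monomials -/

/-- For `T ⊆ [m]` with `#T ≤ a ≤ m` there is a splitting `e : [a] ⊔ [m-a] ≃ [m]` such that every `e (1 ⊔ ρ) e⁻¹`,
`ρ ∈ 𝔖_{m-a}`, fixes `T` pointwise. [folklore] -/
theorem exists_splitting_fixing_finset {a : ℕ} (ha : a ≤ m) (T : Finset (Fin m)) (hT : T.card ≤ a) :
    ∃ e : Fin a ⊕ Fin (m - a) ≃ Fin m, ∀ x ∈ T, ∀ ρ : Perm (Fin (m - a)),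
      e.permCongr ((1 : Perm (Fin a)).sumCongr ρ) x = x := by
  classical
  obtain ⟨S, hTS, -, hS⟩ := Finset.exists_subsuperset_card_eq (Finset.subset_univ T) hT
    (by rw [Finset.card_univ, Fintype.card_fin]; exact ha)
  have hS2 : Fintype.card {x // x ∈ S} = a := by rw [Fintype.card_coe, hS]
  have hSc : Fintype.card {x // ¬ x ∈ S} = m - a := by
    rw [Fintype.card_subtype_compl, Fintype.card_fin, hS2]
  refine ⟨((Fintype.equivFinOfCardEq hS2).symm.sumCongr (Fintype.equivFinOfCardEq hSc).symm).trans
    (Equiv.sumCompl fun x => x ∈ S), fun x hx ρ => ?_⟩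
  simp [Equiv.permCongr_apply, Equiv.sumCompl_symm_apply_of_pos (hTS hx)]

/-- A relabelling fixing the letters of `β` fixes `x^β`. [folklore] -/
theorem rename_monomial_eq_self {σ : Type*} (f : σ → σ) (β : σ →₀ ℕ) (hf : ∀ x ∈ β.support, f x = x) (c : ℂ) :
    rename f (monomial β c) = monomial β c := by
  have hβ : Finsupp.mapDomain f β = β :=
    calc Finsupp.mapDomain f β = ∑ x ∈ β.support, Finsupp.single (f x) (β x) := rfl
      _ = ∑ x ∈ β.support, Finsupp.single x (β x) := Finset.sum_congr rfl fun x hx => by rw [hf x hx]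
      _ = β := β.sum_single
  rw [rename_monomial, hβ]

/-- A degree-`d` exponent on the `m × m` matrix has at most `d` row letters and at most `d` column letters. [folklore] -/
theorem card_image_support_le {d : ℕ} (β : Fin m × Fin m →₀ ℕ) (hβ : β.degree = d) :
    (β.support.image Prod.fst).card ≤ d ∧ (β.support.image Prod.snd).card ≤ d := by
  have h : β.support.card ≤ d := by
    rw [← hβ, Finsupp.degree_apply, Finset.card_eq_sum_ones]
    exact Finset.sum_le_sum fun x hx => Nat.one_le_iff_ne_zero.2 (Finsupp.mem_support_iff.1 hx)
  exact ⟨Finset.card_image_le.trans h, Finset.card_image_le.trans h⟩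

/-! ## §2 The depth window -/

/-- ★ For `λ₁ < m - d` or `μ₁ < m - d` (`d ≤ m`) the `χ^λ ⊠ χ^μ`-weighted symmetriser kills every monomial `c·x^β` of
degree `d`: `x^β` is fixed by `K × K'`, `K, K' ≅ 𝔖_{m-d}` the pointwise stabilisers of `d` row / column letters
containing those of `β`, and `∑_K χ^λ · ∑_{K'} χ^μ = 0` by Pieri. [this file] -/
theorem sum_boxProd_smul_rename_monomial_eq_zero {d : ℕ} (hd : d ≤ m) {la mu : Nat.Partition m}
    (h : ¬ (m ≤ la.sortedParts.getD 0 0 + d ∧ m ≤ mu.sortedParts.getD 0 0 + d)) (β : Fin m × Fin m →₀ ℕ)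
    (hβ : β.degree = d) (c : ℂ) :
    ∑ t : Perm (Fin m) × Perm (Fin m), (spechtCharacter ℂ la t.1 * spechtCharacter ℂ mu t.2) •
      rename (Equiv.prodCongr t.1⁻¹ t.2⁻¹) (monomial β c) = 0 := by
  classical
  -- the cyclic `𝔖_m × 𝔖_m`-module `V` of `u = c·x^β`
  set u : MvPolynomial (Fin m × Fin m) ℂ := monomial β c
  set V : Submodule ℂ (MvPolynomial (Fin m × Fin m) ℂ) :=
    Submodule.span ℂ (Set.range fun t : Perm (Fin m) × Perm (Fin m) => rename (Equiv.prodCongr t.1 t.2) u)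
  haveI : FiniteDimensional ℂ V := FiniteDimensional.span_of_finite ℂ (Set.finite_range _)
  obtain ⟨ρ, hρ⟩ := exists_representation_of_stable V fun g w hw => rename_mem_span_translates u g hw
  have hid : (⇑(Equiv.prodCongr (1 : Perm (Fin m)) (1 : Perm (Fin m))) : Fin m × Fin m → Fin m × Fin m) = id :=
    funext fun ⟨i, j⟩ => rfl
  have hu : u ∈ V := by
    have h1 : rename (Equiv.prodCongr (1 : Perm (Fin m)) (1 : Perm (Fin m))) u ∈ V := Submodule.subset_span ⟨1, rfl⟩
    rwa [hid, rename_id_apply] at h1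
  -- splittings whose `𝔖_{m-d}` fixes the row letters, resp. the column letters, of `β`
  obtain ⟨hr, hc⟩ := card_image_support_le β hβ
  obtain ⟨e, he⟩ := exists_splitting_fixing_finset hd (β.support.image Prod.fst) hr
  obtain ⟨e', he'⟩ := exists_splitting_fixing_finset hd (β.support.image Prod.snd) hc
  -- the subgroup `N = Φ(𝔖_{m-d} × 𝔖_{m-d})` (Young embeddings of `EquivariantDialLayersApolarKill`)
  obtain ⟨φ, hφinj, hφ⟩ := exists_monoidHom_sumCongr e
  obtain ⟨φ', hφ'inj, hφ'⟩ := exists_monoidHom_sumCongr e'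
  let Φ : Perm (Fin (m - d)) × Perm (Fin (m - d)) →* Perm (Fin m) × Perm (Fin m) := MonoidHom.prodMap φ φ'
  have hΦ : ∀ x, Φ x = (φ x.1, φ' x.2) := fun _ => rfl
  have hΦinj : Function.Injective Φ := fun x y hxy =>
    have h1 : φ x.1 = φ y.1 := congrArg Prod.fst hxy
    have h2 : φ' x.2 = φ' y.2 := congrArg Prod.snd hxy
    Prod.ext (hφinj h1) (hφ'inj h2)
  -- `u` is fixed by `N`
  have hfix : ∀ n ∈ Φ.range, ρ n ⟨u, hu⟩ = ⟨u, hu⟩ := by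
    rintro _ ⟨x, rfl⟩
    apply Subtype.ext
    rw [hρ, hΦ, Submodule.coe_mk]
    refine rename_monomial_eq_self _ β (fun y hy => ?_) c
    obtain ⟨i, j⟩ := y
    show ((φ x.1) i, (φ' x.2) j) = (i, j)
    rw [hφ, hφ', he i (Finset.mem_image_of_mem Prod.fst hy) x.1, he' j (Finset.mem_image_of_mem Prod.snd hy) x.2]
  -- `χ = χ^λ ⊠ χ^μ` is irreducible and `∑_N χ = (∑_{𝔖_{m-d}} χ^λ ∘ φ)(∑_{𝔖_{m-d}} χ^μ ∘ φ') = 0`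
  have hχ : IsIrrChar (Perm (Fin m) × Perm (Fin m))
      (fun t : Perm (Fin m) × Perm (Fin m) => spechtCharacter ℂ la t.1 * spechtCharacter ℂ mu t.2) :=
    (isIrrChar_spechtCharacter la).boxProd (isIrrChar_spechtCharacter mu)
  have h0 : ∑ n : ↥Φ.range,
      (fun t : Perm (Fin m) × Perm (Fin m) => spechtCharacter ℂ la t.1 * spechtCharacter ℂ mu t.2) n = 0 := by
    have hinj : Function.Injective
        (fun x : Perm (Fin (m - d)) × Perm (Fin (m - d)) => (⟨Φ x, ⟨x, rfl⟩⟩ : ↥Φ.range)) :=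
      fun x y hxy => hΦinj (congrArg Subtype.val hxy)
    have hsurj : Function.Surjective
        (fun x : Perm (Fin (m - d)) × Perm (Fin (m - d)) => (⟨Φ x, ⟨x, rfl⟩⟩ : ↥Φ.range)) := by
      rintro ⟨_, x, rfl⟩
      exact ⟨x, rfl⟩
    have hsum : ∑ n : ↥Φ.range,
        (fun t : Perm (Fin m) × Perm (Fin m) => spechtCharacter ℂ la t.1 * spechtCharacter ℂ mu t.2) n =
        ∑ x : Perm (Fin (m - d)) × Perm (Fin (m - d)),
          (fun t : Perm (Fin m) × Perm (Fin m) => spechtCharacter ℂ la t.1 * spechtCharacter ℂ mu t.2) (Φ x) :=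
      (Fintype.sum_bijective _ ⟨hinj, hsurj⟩
        (fun x => (fun t : Perm (Fin m) × Perm (Fin m) =>
          spechtCharacter ℂ la t.1 * spechtCharacter ℂ mu t.2) (Φ x))
        (fun n : ↥Φ.range => (fun t : Perm (Fin m) × Perm (Fin m) =>
          spechtCharacter ℂ la t.1 * spechtCharacter ℂ mu t.2) n)
        (fun _ => rfl)).symm
    rw [hsum]
    simp only [hΦ, hφ, hφ', Fintype.sum_prod_type]
    rw [← Finset.sum_mul_sum]
    rcases not_and_or.1 h with hla | hmu
    · have hz : ∑ r : Perm (Fin (m - d)), spechtCharacter ℂ la (e.permCongr ((1 : Perm (Fin d)).sumCongr r)) = 0 :=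
        not_not.1 fun hne => hla (le_getD_add_of_sum_ne_zero e la hne)
      rw [hz, zero_mul]
    · have hz : ∑ r : Perm (Fin (m - d)), spechtCharacter ℂ mu (e'.permCongr ((1 : Perm (Fin d)).sumCongr r)) = 0 :=
        not_not.1 fun hne => hmu (le_getD_add_of_sum_ne_zero e' mu hne)
      rw [hz, mul_zero]
  -- hence `P_χ u = 0`; read off the polynomial identity
  have hP := isotypicProj_eq_zero_of_sum_eq_zero ρ Φ.range hχ h0 hfix
  have hval := congrArg Subtype.val hP
  rw [coe_isotypicProj ρ hρ, Submodule.coe_zero, sum_mul_smul_eq] at hval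
  exact (smul_eq_zero.1 hval).resolve_left (div_ne_zero hχ.apply_one_ne_zero (Nat.cast_ne_zero.2 Fintype.card_ne_zero))

/-- ★★ DEPTH WINDOW: for every form `v` of degree `d ≤ m` and all `λ, μ ⊢ m` with `λ₁ < m - d` or `μ₁ < m - d`,
`∑_{(g,h)} χ^λ(g) χ^μ(h) · (g,h)⁻¹·v = 0`; i.e. `R_d` only has types `λ ⊠ μ` with `λ₁, μ₁ ≥ m - d`
(`d = 2`: `EquivariantDialLayersQuadricTypes.sum_boxProd_smul_rename_eq_zero`). [this file] -/
theorem sum_boxProd_smul_rename_eq_zero_of_isHomogeneous {d : ℕ} (hd : d ≤ m) {la mu : Nat.Partition m}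
    (h : ¬ (m ≤ la.sortedParts.getD 0 0 + d ∧ m ≤ mu.sortedParts.getD 0 0 + d))
    {v : MvPolynomial (Fin m × Fin m) ℂ} (hv : v.IsHomogeneous d) :
    ∑ t : Perm (Fin m) × Perm (Fin m), (spechtCharacter ℂ la t.1 * spechtCharacter ℂ mu t.2) •
      rename (Equiv.prodCongr t.1⁻¹ t.2⁻¹) v = 0 := by
  set L : MvPolynomial (Fin m × Fin m) ℂ →ₗ[ℂ] MvPolynomial (Fin m × Fin m) ℂ :=
    ∑ t : Perm (Fin m) × Perm (Fin m), (spechtCharacter ℂ la t.1 * spechtCharacter ℂ mu t.2) •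
      (rename (Equiv.prodCongr t.1⁻¹ t.2⁻¹)).toLinearMap with hLdef
  have hL : ∀ w, L w = ∑ t : Perm (Fin m) × Perm (Fin m), (spechtCharacter ℂ la t.1 * spechtCharacter ℂ mu t.2) •
      rename (Equiv.prodCongr t.1⁻¹ t.2⁻¹) w := fun w => by
    simp only [hLdef, LinearMap.sum_apply, LinearMap.smul_apply, AlgHom.toLinearMap_apply]
  rw [← hL, v.as_sum, map_sum]
  refine Finset.sum_eq_zero fun β hβ => ?_
  have hdeg : β.degree = d := by
    by_contra hne
    exact (MvPolynomial.mem_support_iff.1 hβ) (hv.coeff_eq_zero hne)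
  rw [hL]
  exact sum_boxProd_smul_rename_monomial_eq_zero hd h β hdeg (coeff β v)

end Summit.ValiantsHypothesis.ValiantsHypothesis.Theorems.EquivariantDialLayersDepthWindow
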